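import Literature.NumberTheory.Automorphic.ArchGardingMeasureSmoothing
import Literature.NumberTheory.Automorphic.ArchMeasureConvTestFunction
import Literature.NumberTheory.Automorphic.ArchWhittakerInfinitesimal
import Mathlib.MeasureTheory.Group.Integral
import HarnessLib

/-!
# Smoothing along the unipotent radical of the mirabolic of `GL₂(K_∞)`: `S_U(g) v = ∫ g(x) τ(n(x)) v dx`

Topic `NumberTheory/Automorphic`; namespace `Literature.NumberTheory.Automorphic`. Definitions with
bodies and theorems (no named fact). For a strongly continuous representation `τ` of `GL₂(K_∞)` by
operators of norm `≤ 1` on a Banach space `E` and a continuous compactly supported kernel `g` on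
`K_∞ = mixedSpace K`, the **unipotent smoothing** `unipSmoothing hcpt τ g v = ∫ g(x) • τ(n(x)) v dx`
(`n(x) = unipotentGL2 x`; Jacquet–Shalika (1981), §3: the integrated representation of `U` on smooth
vectors). We PROVE:

* `weightedIntegral_apply_toArch_mem_archGardingSpace` — **weighted smoothings by compactly supported
  continuous kernels along a continuous map `Ω → GL_n(K_∞)` preserve the Gårding space** (split the
  kernel into four nonnegative parts and use `ArchMeasureConvTestFunction`); in particular
  `unipSmoothing_mem_archGardingSpace`;
* `unipSmoothing_eq_integral_map` — `S_U(g) v` as a smoothing by the finite compactly carried measure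
  `n_*(g dx)` on `GL₂(K_∞)` (so that `ArchGardingMeasureSmoothing` applies);
* `archDerivE_single01_unipSmoothing` — **absorption of the `𝔲`-letters**:
  `τ(E₀₁ ⊗ b) S_U(g) v = S_U(-∂_b g) v` for `g ∈ C_c^1` and every `v ∈ E` (translate the kernel,
  differentiate under the integral);
* `archDerivE_unipSmoothing_of_mem` — for Gårding `v`, `τ(X) S_U(g) v = ∫ g(x) τ(n(x)) τ(n(-x) X n(x)) v dx`,
  whence `unipSmoothing_archDerivE_single01` (`S_U(g) τ(E₀₁⊗b) v = S_U(-∂_b g) v`) and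
  `archDerivE_single00_unipSmoothing` — **commuting the diagonal letters**:
  `τ(E₀₀ ⊗ a) S_U(g) v = S_U(g) τ(E₀₀ ⊗ a) v + Σ_b S_U(-∂_{e_b a}(x_b g)) v`;
* `apply_unipSmoothing_eq` — **Whittaker functionals see `S_U(g)` as the scalar `ĝ(1)`**:
  `ℓ(S_U(g) y) = (∫ g ψ_∞) ℓ(y)`, and `kirillovFn_unipSmoothing` —
  `W_{S_U(g) v}(u) = (∫ g(x) ψ_∞(u x) dx) W_v(u)`.

## References

* H. Jacquet, J. A. Shalika, *On Euler products and the classification of automorphic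
  representations I*, Amer. J. Math. 103 (1981), §3, (3.1)–(3.3), §4 [JacquetShalikaAJM1981].
* G. B. Folland, *A Course in Abstract Harmonic Analysis* (1995), §3.1 [Folland1995].
-/

noncomputable section

open MeasureTheory Measure NumberField NumberField.mixedEmbedding NumberField.InfinitePlace IsDedekindDomain Set Filter
  Complex
open scoped MatrixGroups ENNReal NNReal Classical Topology ComplexConjugate Real InnerProductSpace Pointwise

namespace Literature.NumberTheory.Automorphic

variable {K : Type} [Field K] [NumberField K]

attribute [local instance] glInfBorel borelSpace_glInf locallyCompactSpace_glInf secondCountableTopology_glInf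

-- as in `ArchGardingWhittaker`
set_option backward.isDefEq.respectTransparency false

/-! ### 1. Weighted smoothings along continuous maps preserve the Gårding space -/

section Weighted

variable {n : ℕ} {hcpt : isCompact_glFiniteIntegralLevel n K}
  {E : Type*} [NormedAddCommGroup E] [NormedSpace ℂ E] [CompleteSpace E]
  {τ : ContRepresentation ℂ (AutomorphyDatum.gl n K hcpt).arch.carrier E}
  {Ω : Type*} [TopologicalSpace Ω] [MeasurableSpace Ω] [OpensMeasurableSpace Ω]

omit [CompleteSpace E] in
/-- A nonnegative weighted smoothing is a smoothing by the push-forward of the weighted measure: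
`∫ f(t) • τ(c(t)) v dm = ∫ τ(h) v d(c_*(f m))`. [folklore] -/
theorem integral_nnreal_smul_apply_toArch_eq (m : Measure Ω) {c : Ω → GL (Fin n) (mixedSpace K)} (hc : Continuous c)
    {f : Ω → ℝ≥0} (hf : Measurable f) (hτ : τ.IsStronglyContinuous) (v : E) :
    ∫ t, (f t : ℝ) • τ (toArch hcpt (c t)) v ∂m = ∫ h, τ (toArch hcpt h) v ∂((m.withDensity fun t => f t).map c) := by
  rw [integral_map hc.measurable.aemeasurable (continuous_apply_toArch hcpt τ hτ v).aestronglyMeasurable,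
    integral_withDensity_eq_integral_smul hf]
  rfl

/-- **Smoothing by a nonnegative continuous compactly supported weight preserves the Gårding space.**
[folklore] -/
theorem integral_nnreal_smul_apply_toArch_mem (m : Measure Ω) [IsFiniteMeasureOnCompacts m]
    {c : Ω → GL (Fin n) (mixedSpace K)} (hc : Continuous c) {f : Ω → ℝ≥0} (hf : Continuous f) (hfs : HasCompactSupport f)
    (hτ : τ.IsStronglyContinuous) (hτb : ∀ g, ‖(τ g : E →L[ℂ] E)‖ ≤ 1) {v : E} (hv : v ∈ archGardingSpace hcpt τ) :
    ∫ t, (f t : ℝ) • τ (toArch hcpt (c t)) v ∂m ∈ archGardingSpace hcpt τ := by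
  rw [integral_nnreal_smul_apply_toArch_eq m hc hf.measurable hτ v]
  set ν : Measure (GL (Fin n) (mixedSpace K)) := (m.withDensity fun t => f t).map c with hν
  -- `ν` is finite
  have hfin : IsFiniteMeasure (m.withDensity fun t => f t) := by
    have hint : Integrable (fun t => (f t : ℝ)) m := (NNReal.continuous_coe.comp hf).integrable_of_hasCompactSupport (hfs.comp_left NNReal.coe_zero)
    refine isFiniteMeasure_withDensity (ne_of_lt ?_)
    have h := hint.lintegral_lt_top
    refine lt_of_le_of_lt (le_of_eq (lintegral_congr fun t => ?_)) h
    rw [ENNReal.ofReal_coe_nnreal]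
  haveI : IsFiniteMeasure ν := by rw [hν]; exact Measure.isFiniteMeasure_map _ _
  -- `ν` is carried by the compact `c '' tsupport f`
  have hκ : IsCompact (c '' tsupport f) := hfs.isCompact.image hc
  have hνκ : ∀ᵐ h ∂ν, h ∈ c '' tsupport f := by
    rw [hν]
    refine (ae_map_iff hc.measurable.aemeasurable hκ.isClosed.measurableSet).2 ?_
    rw [ae_withDensity_iff hf.measurable.coe_nnreal_ennreal]
    refine ae_of_all _ fun t ht => ⟨t, ?_, rfl⟩
    by_contra hnot
    exact ht (by rw [image_eq_zero_of_notMem_tsupport hnot, ENNReal.coe_zero])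
  exact integral_apply_toArch_mem_archGardingSpace hτ hτb hκ hνκ hv

/-- **Weighted smoothings by complex continuous compactly supported kernels preserve the Gårding space**
(split `f = f₁ - f₂ + i (f₃ - f₄)` with `f_i ≥ 0` continuous of compact support). [folklore] -/
theorem weightedIntegral_apply_toArch_mem_archGardingSpace (m : Measure Ω) [IsFiniteMeasureOnCompacts m]
    {c : Ω → GL (Fin n) (mixedSpace K)} (hc : Continuous c) {f : Ω → ℂ} (hf : Continuous f) (hfs : HasCompactSupport f)
    (hτ : τ.IsStronglyContinuous) (hτb : ∀ g, ‖(τ g : E →L[ℂ] E)‖ ≤ 1) {v : E} (hv : v ∈ archGardingSpace hcpt τ) :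
    ∫ t, f t • τ (toArch hcpt (c t)) v ∂m ∈ archGardingSpace hcpt τ := by
  -- the four nonnegative parts
  set p₁ : Ω → ℝ≥0 := fun t => Real.toNNReal (f t).re with hp₁
  set p₂ : Ω → ℝ≥0 := fun t => Real.toNNReal (-(f t).re) with hp₂
  set p₃ : Ω → ℝ≥0 := fun t => Real.toNNReal (f t).im with hp₃
  set p₄ : Ω → ℝ≥0 := fun t => Real.toNNReal (-(f t).im) with hp₄
  have hc₁ : Continuous p₁ := continuous_real_toNNReal.comp (Complex.continuous_re.comp hf)
  have hc₂ : Continuous p₂ := continuous_real_toNNReal.comp ((Complex.continuous_re.comp hf).neg)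
  have hc₃ : Continuous p₃ := continuous_real_toNNReal.comp (Complex.continuous_im.comp hf)
  have hc₄ : Continuous p₄ := continuous_real_toNNReal.comp ((Complex.continuous_im.comp hf).neg)
  have hsupp : ∀ {p : Ω → ℝ≥0}, (∀ t, f t = 0 → p t = 0) → HasCompactSupport p := by
    intro p hp
    refine hfs.mono fun t ht => ?_
    rw [Function.mem_support] at ht ⊢
    exact fun h0 => ht (hp t h0)
  have hs₁ : HasCompactSupport p₁ := hsupp fun t h => by simp [hp₁, h]
  have hs₂ : HasCompactSupport p₂ := hsupp fun t h => by simp [hp₂, h]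
  have hs₃ : HasCompactSupport p₃ := hsupp fun t h => by simp [hp₃, h]
  have hs₄ : HasCompactSupport p₄ := hsupp fun t h => by simp [hp₄, h]
  have hdec : ∀ t, f t = ((p₁ t : ℝ) : ℂ) - ((p₂ t : ℝ) : ℂ) + I * (((p₃ t : ℝ) : ℂ) - ((p₄ t : ℝ) : ℂ)) := by
    intro t
    have hre : ((p₁ t : ℝ)) - (p₂ t : ℝ) = (f t).re := by
      simp only [hp₁, hp₂, Real.coe_toNNReal']
      rcases le_total 0 (f t).re with h | h
      · rw [max_eq_left h, max_eq_right (by linarith), sub_zero]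
      · rw [max_eq_right h, max_eq_left (by linarith)]; ring
    have him : ((p₃ t : ℝ)) - (p₄ t : ℝ) = (f t).im := by
      simp only [hp₃, hp₄, Real.coe_toNNReal']
      rcases le_total 0 (f t).im with h | h
      · rw [max_eq_left h, max_eq_right (by linarith), sub_zero]
      · rw [max_eq_right h, max_eq_left (by linarith)]; ring
    apply Complex.ext
    · simp [← hre]
    · simp [← him]
  -- integrability of each part
  have hint : ∀ {p : Ω → ℝ≥0}, Continuous p → HasCompactSupport p → Integrable (fun t => (p t : ℝ) • τ (toArch hcpt (c t)) v) m := by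
    intro p hp hps
    refine ((continuous_subtype_val.comp hp).smul ((continuous_apply_toArch hcpt τ hτ v).comp hc)).integrable_of_hasCompactSupport ?_
    exact (hps.comp_left NNReal.coe_zero).smul_right
  have h₁ := integral_nnreal_smul_apply_toArch_mem m hc hc₁ hs₁ hτ hτb hv
  have h₂ := integral_nnreal_smul_apply_toArch_mem m hc hc₂ hs₂ hτ hτb hv
  have h₃ := integral_nnreal_smul_apply_toArch_mem m hc hc₃ hs₃ hτ hτb hv
  have h₄ := integral_nnreal_smul_apply_toArch_mem m hc hc₄ hs₄ hτ hτb hv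
  have heq : (fun t => f t • τ (toArch hcpt (c t)) v) = fun t =>
      ((p₁ t : ℝ) • τ (toArch hcpt (c t)) v - (p₂ t : ℝ) • τ (toArch hcpt (c t)) v) +
        I • ((p₃ t : ℝ) • τ (toArch hcpt (c t)) v - (p₄ t : ℝ) • τ (toArch hcpt (c t)) v) := by
    funext t
    rw [hdec t]
    simp only [add_smul, sub_smul, mul_smul, smul_sub, Complex.coe_smul]
  have hA : Integrable (fun t => (p₁ t : ℝ) • τ (toArch hcpt (c t)) v - (p₂ t : ℝ) • τ (toArch hcpt (c t)) v) m :=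
    (hint hc₁ hs₁).sub (hint hc₂ hs₂)
  have hB : Integrable (fun t => I • ((p₃ t : ℝ) • τ (toArch hcpt (c t)) v - (p₄ t : ℝ) • τ (toArch hcpt (c t)) v)) m :=
    ((hint hc₃ hs₃).sub (hint hc₄ hs₄)).smul I
  rw [heq, integral_add hA hB, integral_sub (hint hc₁ hs₁) (hint hc₂ hs₂), integral_smul, integral_sub (hint hc₃ hs₃) (hint hc₄ hs₄)]
  exact Submodule.add_mem _ (Submodule.sub_mem _ h₁ h₂) (Submodule.smul_mem _ _ (Submodule.sub_mem _ h₃ h₄))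

end Weighted

/-! ### 2. The unipotent smoothing of `GL₂(K_∞)` -/

section Unipotent

variable {hcpt : isCompact_glFiniteIntegralLevel 2 K}
  {E : Type*} [NormedAddCommGroup E] [NormedSpace ℂ E] [CompleteSpace E]
  {τ : ContRepresentation ℂ (AutomorphyDatum.gl 2 K hcpt).arch.carrier E}

variable (K) in
/-- `n(x) = (1 x; 0 1) ∈ GL₂(K_∞)`. [folklore] -/
abbrev unipGL (x : mixedSpace K) : GL (Fin 2) (mixedSpace K) :=
  ((unipotentGL2 x : ↥(upperUnitriangular (Fin 2) (mixedSpace K))) : GL (Fin 2) (mixedSpace K))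

omit [NumberField K] in
/-- The matrix of `n(x)`. [folklore] -/
theorem coe_unipGL (x : mixedSpace K) : ((unipGL K x : GL (Fin 2) (mixedSpace K)) : Matrix (Fin 2) (Fin 2) (mixedSpace K)) = !![1, x; 0, 1] :=
  coe_unipotentGL2 x

omit [NumberField K] in
/-- `n(x + y) = n(x) n(y)`. [folklore] -/
theorem unipGL_add (x y : mixedSpace K) : unipGL K (x + y) = unipGL K x * unipGL K y := by
  change ((unipotentGL2 (x + y) : ↥(upperUnitriangular (Fin 2) (mixedSpace K))) : GL (Fin 2) (mixedSpace K)) = _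
  rw [unipotentGL2_add]
  rfl

omit [NumberField K] in
/-- `x ↦ n(x)` is continuous. [folklore] -/
theorem continuous_unipGL : Continuous (unipGL K) := by
  refine Units.continuous_iff.2 ⟨?_, ?_⟩
  · rw [show (Units.val ∘ unipGL K) = fun x => !![1, x; 0, 1] from funext fun x => coe_unipGL x]
    refine continuous_matrix fun i j => ?_
    fin_cases i <;> fin_cases j
    · exact continuous_const
    · exact continuous_id
    · exact continuous_const
    · exact continuous_const
  · have h : (fun x => (((unipGL K x)⁻¹ : GL (Fin 2) (mixedSpace K)) : Matrix (Fin 2) (Fin 2) (mixedSpace K))) = fun x => !![1, -x; 0, 1] := by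
      funext x
      have : (unipGL K x)⁻¹ = unipGL K (-x) := by
        rw [eq_comm, ← mul_eq_one_iff_eq_inv, ← unipGL_add, neg_add_cancel]
        change ((unipotentGL2 (0 : mixedSpace K) : ↥(upperUnitriangular (Fin 2) (mixedSpace K))) : GL (Fin 2) (mixedSpace K)) = 1
        rw [unipotentGL2_zero]; rfl
      rw [this]; exact coe_unipGL (-x)
    rw [h]
    refine continuous_matrix fun i j => ?_
    fin_cases i <;> fin_cases j
    · exact continuous_const
    · exact continuous_neg
    · exact continuous_const
    · exact continuous_const

/-- `n(s b) = exp(s · E₀₁ ⊗ b)`. [folklore] -/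
theorem unipGL_smul_eq_expGL (b : mixedSpace K) (s : ℝ) :
    unipGL K (s • b) = expGL (s • Matrix.single (0 : Fin 2) (1 : Fin 2) b) := by
  refine Units.ext ?_
  rw [coe_expGL_smul_single (by decide) b s, coe_unipGL, Matrix.transvection]
  refine Matrix.ext fun i j => ?_
  fin_cases i <;> fin_cases j <;> simp

variable (hcpt τ) in
/-- **The unipotent smoothing** `S_U(g) v = ∫ g(x) • τ(n(x)) v dx` (Lebesgue measure `volume` on
`K_∞`). [cite: JacquetShalikaAJM1981, §3, (3.1)] -/
def unipSmoothing (g : mixedSpace K → ℂ) (v : E) : E := ∫ x, g x • τ (toArch hcpt (unipGL K x)) v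

omit [CompleteSpace E] in
/-- The integrand of `S_U(g) v` is integrable for `g` continuous of compact support. [folklore] -/
theorem integrable_unipSmoothing_integrand (hτ : τ.IsStronglyContinuous) {g : mixedSpace K → ℂ} (hg : Continuous g)
    (hgs : HasCompactSupport g) (v : E) : Integrable (fun x => g x • τ (toArch hcpt (unipGL K x)) v) :=
  (hg.smul ((continuous_apply_toArch hcpt τ hτ v).comp continuous_unipGL)).integrable_of_hasCompactSupport hgs.smul_right

omit [CompleteSpace E] in
/-- `‖S_U(g) v‖ ≤ ‖g‖_{L¹} ‖v‖` for `‖τ(·)‖ ≤ 1` and `g` continuous of compact support. [folklore] -/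
theorem norm_unipSmoothing_le (hτ : τ.IsStronglyContinuous) (hτb : ∀ g, ‖(τ g : E →L[ℂ] E)‖ ≤ 1) {g : mixedSpace K → ℂ}
    (hg : Continuous g) (hgs : HasCompactSupport g) (v : E) :
    ‖unipSmoothing hcpt τ g v‖ ≤ (∫ x, ‖g x‖) * ‖v‖ := by
  unfold unipSmoothing
  have hint := integrable_unipSmoothing_integrand hτ hg hgs v
  have hint' : Integrable (fun x => ‖g x‖ * ‖v‖) := (hg.norm.integrable_of_hasCompactSupport hgs.norm).mul_const _
  calc ‖∫ x, g x • τ (toArch hcpt (unipGL K x)) v‖ ≤ ∫ x, ‖g x • τ (toArch hcpt (unipGL K x)) v‖ := norm_integral_le_integral_norm _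
    _ ≤ ∫ x, ‖g x‖ * ‖v‖ := by
        refine integral_mono hint.norm hint' fun x => ?_
        rw [_root_.norm_smul]
        refine mul_le_mul_of_nonneg_left ?_ (norm_nonneg _)
        exact (ContinuousLinearMap.le_opNorm _ _).trans (by nlinarith [hτb (toArch hcpt (unipGL K x)), norm_nonneg v])
    _ = (∫ x, ‖g x‖) * ‖v‖ := integral_mul_const _ _

omit [CompleteSpace E] in
/-- `S_U(g)` is additive in the kernel. [folklore] -/
theorem unipSmoothing_add_kernel (hτ : τ.IsStronglyContinuous) {g g' : mixedSpace K → ℂ} (hg : Continuous g) (hgs : HasCompactSupport g)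
    (hg' : Continuous g') (hgs' : HasCompactSupport g') (v : E) :
    unipSmoothing hcpt τ (g + g') v = unipSmoothing hcpt τ g v + unipSmoothing hcpt τ g' v := by
  unfold unipSmoothing
  rw [← integral_add (integrable_unipSmoothing_integrand hτ hg hgs v) (integrable_unipSmoothing_integrand hτ hg' hgs' v)]
  exact integral_congr_ae (Eventually.of_forall fun x => by simp [add_smul])

omit [CompleteSpace E] in
/-- `S_U(c g) = c S_U(g)`. [folklore] -/
theorem unipSmoothing_smul_kernel (c : ℂ) (g : mixedSpace K → ℂ) (v : E) :
    unipSmoothing hcpt τ (c • g) v = c • unipSmoothing hcpt τ g v := by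
  unfold unipSmoothing
  rw [← integral_smul]
  exact integral_congr_ae (Eventually.of_forall fun x => by simp [mul_smul])

omit [CompleteSpace E] in
/-- `S_U(g)` is linear in the vector. [folklore] -/
theorem unipSmoothing_add_vec (hτ : τ.IsStronglyContinuous) {g : mixedSpace K → ℂ} (hg : Continuous g) (hgs : HasCompactSupport g) (v v' : E) :
    unipSmoothing hcpt τ g (v + v') = unipSmoothing hcpt τ g v + unipSmoothing hcpt τ g v' := by
  unfold unipSmoothing
  rw [← integral_add (integrable_unipSmoothing_integrand hτ hg hgs v) (integrable_unipSmoothing_integrand hτ hg hgs v')]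
  exact integral_congr_ae (Eventually.of_forall fun x => by simp [smul_add])

omit [CompleteSpace E] in
/-- `S_U(g) (c v) = c S_U(g) v`. [folklore] -/
theorem unipSmoothing_smul_vec (g : mixedSpace K → ℂ) (c : ℂ) (v : E) :
    unipSmoothing hcpt τ g (c • v) = c • unipSmoothing hcpt τ g v := by
  unfold unipSmoothing
  rw [← integral_smul]
  exact integral_congr_ae (Eventually.of_forall fun x => by simp only [map_smul]; rw [smul_comm])

/-- **`S_U(g)` preserves the Gårding space.** [cite: JacquetShalikaAJM1981, §3, (3.1)] -/
theorem unipSmoothing_mem_archGardingSpace (hτ : τ.IsStronglyContinuous) (hτb : ∀ g, ‖(τ g : E →L[ℂ] E)‖ ≤ 1)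
    {g : mixedSpace K → ℂ} (hg : Continuous g) (hgs : HasCompactSupport g) {v : E} (hv : v ∈ archGardingSpace hcpt τ) :
    unipSmoothing hcpt τ g v ∈ archGardingSpace hcpt τ :=
  weightedIntegral_apply_toArch_mem_archGardingSpace volume continuous_unipGL hg hgs hτ hτb hv

/-! ### 3. `S_U(g)` as a smoothing by a measure on `GL₂(K_∞)` -/

variable (K) in
/-- The `(0,1)`-entry of a matrix, as the inverse of `x ↦ n(x)` on unipotents. [folklore] -/
def entry01 (h : GL (Fin 2) (mixedSpace K)) : mixedSpace K := (h : Matrix (Fin 2) (Fin 2) (mixedSpace K)) 0 1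

omit [NumberField K] in
/-- `entry01 (n x) = x`. [folklore] -/
@[simp] theorem entry01_unipGL (x : mixedSpace K) : entry01 K (unipGL K x) = x := unipotentGL2_apply_zero_one x

omit [NumberField K] in
/-- `entry01` is continuous. [folklore] -/
theorem continuous_entry01 : Continuous (entry01 K) :=
  (Units.continuous_val (M := Matrix (Fin 2) (Fin 2) (mixedSpace K))).matrix_elem 0 1

variable (K) in
/-- The push-forward measure `n_*(dx|_{supp g})` on `GL₂(K_∞)`. [folklore] -/
def unipMeasure (s : Set (mixedSpace K)) : Measure (GL (Fin 2) (mixedSpace K)) := (volume.restrict s).map (unipGL K)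

/-- `n_*(dx|_s)` is finite for `s` compact. [folklore] -/
theorem isFiniteMeasure_unipMeasure {s : Set (mixedSpace K)} (hs : IsCompact s) : IsFiniteMeasure (unipMeasure K s) := by
  haveI : IsFiniteMeasure (volume.restrict s) := ⟨by rw [Measure.restrict_apply_univ]; exact hs.measure_lt_top⟩
  unfold unipMeasure
  infer_instance

/-- `n_*(dx|_s)` is carried by `n(s)`. [folklore] -/
theorem ae_mem_unipMeasure {s : Set (mixedSpace K)} (hs : IsCompact s) : ∀ᵐ h ∂(unipMeasure K s), h ∈ unipGL K '' s := by
  unfold unipMeasure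
  refine (ae_map_iff continuous_unipGL.measurable.aemeasurable (hs.image continuous_unipGL).isClosed.measurableSet).2 ?_
  rw [ae_restrict_iff' hs.isClosed.measurableSet]
  exact ae_of_all _ fun x hx => ⟨x, hx, rfl⟩

omit [CompleteSpace E] in
/-- **`S_U(g)`-type integrals as smoothings by `n_*(dx|_{supp g})`**: for a family `F` on `GL₂(K_∞)`,
`∫ g(x) • F(n(x)) dx = ∫ (g(entry₀₁ h) • F h) d n_*(dx|_{supp g})`. [folklore] -/
theorem integral_smul_comp_unipGL_eq {g : mixedSpace K → ℂ} (hg : Continuous g) {F : GL (Fin 2) (mixedSpace K) → E}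
    (hF : Continuous F) :
    ∫ x, g x • F (unipGL K x) = ∫ h, g (entry01 K h) • F h ∂(unipMeasure K (tsupport g)) := by
  unfold unipMeasure
  have hmeas : AEStronglyMeasurable (fun h : GL (Fin 2) (mixedSpace K) => g (entry01 K h) • F h)
      (Measure.map (unipGL K) (volume.restrict (tsupport g))) :=
    ((hg.comp continuous_entry01).smul hF).aestronglyMeasurable
  rw [integral_map (f := fun h : GL (Fin 2) (mixedSpace K) => g (entry01 K h) • F h) continuous_unipGL.measurable.aemeasurable hmeas]
  simp only [entry01_unipGL]
  symm
  refine setIntegral_eq_integral_of_forall_compl_eq_zero fun x hx => ?_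
  rw [image_eq_zero_of_notMem_tsupport hx, zero_smul]

omit [CompleteSpace E] in
/-- The family `h ↦ g(entry₀₁ h) • v` is a finite continuous combination of Gårding vectors. [folklore] -/
theorem isGardingContComb_entry01_smul {g : mixedSpace K → ℂ} (hg : Continuous g) {v : E} (hv : v ∈ archGardingSpace hcpt τ) :
    IsGardingContComb hcpt τ (fun h : GL (Fin 2) (mixedSpace K) => g (entry01 K h) • v) :=
  (isGardingContComb_const hv).smul (hg.comp continuous_entry01)

/-- **`τ(w) S_U(g) v` for Gårding `v`**: `= ∫ g(x) τ(n(x)) τ(Ad(n(-x)) w) v dx`. [folklore] -/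
theorem archWordDerivE_unipSmoothing (hτ : τ.IsStronglyContinuous) (hτb : ∀ g, ‖(τ g : E →L[ℂ] E)‖ ≤ 1)
    {g : mixedSpace K → ℂ} (hg : Continuous g) (hgs : HasCompactSupport g) {v : E} (hv : v ∈ archGardingSpace hcpt τ)
    (w : List (Matrix (Fin 2) (Fin 2) (mixedSpace K))) :
    archWordDerivE hcpt τ w (unipSmoothing hcpt τ g v) =
      ∫ x, g x • τ (toArch hcpt (unipGL K x)) (archWordDerivE hcpt τ (w.map fun X =>
        (((unipGL K x)⁻¹ : GL (Fin 2) (mixedSpace K)) : Matrix (Fin 2) (Fin 2) (mixedSpace K)) * X *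
          ((unipGL K x : GL (Fin 2) (mixedSpace K)) : Matrix (Fin 2) (Fin 2) (mixedSpace K))) v) := by
  haveI := isFiniteMeasure_unipMeasure (K := K) hgs.isCompact
  have hx := isGardingContComb_entry01_smul (hcpt := hcpt) (τ := τ) hg hv
  have h1 : unipSmoothing hcpt τ g v = ∫ h, τ (toArch hcpt h) (g (entry01 K h) • v) ∂(unipMeasure K (tsupport g)) := by
    unfold unipSmoothing
    rw [integral_smul_comp_unipGL_eq hg (continuous_apply_toArch hcpt τ hτ v)]
    exact integral_congr_ae (Eventually.of_forall fun h => by simp only [map_smul])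
  rw [h1, archWordDerivE_integral_apply_toArch hτ hτb _ (hgs.isCompact.image continuous_unipGL) (ae_mem_unipMeasure hgs.isCompact) w hx]
  -- back to `dx`
  have hcomb : IsGardingContComb hcpt τ (fun h : GL (Fin 2) (mixedSpace K) => archWordDerivE hcpt τ (w.map fun X =>
      ((h⁻¹ : GL (Fin 2) (mixedSpace K)) : Matrix (Fin 2) (Fin 2) (mixedSpace K)) * X * (h : Matrix (Fin 2) (Fin 2) (mixedSpace K)))
      (g (entry01 K h) • v)) := by
    have h := hx.archWordDerivE_map hτ (w.map fun X => fun h : GL (Fin 2) (mixedSpace K) =>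
      ((h⁻¹ : GL (Fin 2) (mixedSpace K)) : Matrix (Fin 2) (Fin 2) (mixedSpace K)) * X * (h : Matrix (Fin 2) (Fin 2) (mixedSpace K)))
      (fun Xf hXf => by
        obtain ⟨Y, -, rfl⟩ := List.mem_map.1 hXf
        exact continuous_conj_inv Y)
    simpa only [List.map_map, Function.comp_def] using h
  have hF : Continuous fun h : GL (Fin 2) (mixedSpace K) => τ (toArch hcpt h) (archWordDerivE hcpt τ (w.map fun X =>
      ((h⁻¹ : GL (Fin 2) (mixedSpace K)) : Matrix (Fin 2) (Fin 2) (mixedSpace K)) * X * (h : Matrix (Fin 2) (Fin 2) (mixedSpace K))) v) := by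
    have hv' := (isGardingContComb_const (T := GL (Fin 2) (mixedSpace K)) hv).archWordDerivE_map hτ
      (w.map fun X => fun h : GL (Fin 2) (mixedSpace K) =>
        ((h⁻¹ : GL (Fin 2) (mixedSpace K)) : Matrix (Fin 2) (Fin 2) (mixedSpace K)) * X * (h : Matrix (Fin 2) (Fin 2) (mixedSpace K)))
      (fun Xf hXf => by
        obtain ⟨Y, -, rfl⟩ := List.mem_map.1 hXf
        exact continuous_conj_inv Y)
    simp only [List.map_map, Function.comp_def] at hv'
    simpa only [one_mul] using continuous_apply_toArch_mul_comb hτ hv' 1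
  rw [integral_smul_comp_unipGL_eq hg hF]
  refine integral_congr_ae (Eventually.of_forall fun h => ?_)
  dsimp only
  rw [archWordDerivE_smul hτ _ hv, map_smul]

/-! ### 4. Absorption of the `𝔲`-letters -/

omit [NumberField K] in
/-- `Ad(n(-x)) (E₀₁ ⊗ b) = E₀₁ ⊗ b` (`U` is abelian). [folklore] -/
theorem unipGL_inv_mul_single01_mul (x b : mixedSpace K) :
    (((unipGL K x)⁻¹ : GL (Fin 2) (mixedSpace K)) : Matrix (Fin 2) (Fin 2) (mixedSpace K)) * Matrix.single 0 1 b *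
      ((unipGL K x : GL (Fin 2) (mixedSpace K)) : Matrix (Fin 2) (Fin 2) (mixedSpace K)) = Matrix.single 0 1 b := by
  have hinv : (unipGL K x)⁻¹ = unipGL K (-x) := by
    rw [eq_comm, ← mul_eq_one_iff_eq_inv, ← unipGL_add, neg_add_cancel]
    change ((unipotentGL2 (0 : mixedSpace K) : ↥(upperUnitriangular (Fin 2) (mixedSpace K))) : GL (Fin 2) (mixedSpace K)) = 1
    rw [unipotentGL2_zero]; rfl
  rw [hinv, coe_unipGL, coe_unipGL]
  refine Matrix.ext fun i j => ?_
  simp only [Matrix.mul_apply, Fin.sum_univ_two]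
  fin_cases i <;> fin_cases j <;> simp

omit [NumberField K] in
/-- `Ad(n(-x)) (E₀₀ ⊗ a) = E₀₀ ⊗ a + E₀₁ ⊗ (x a)`. [folklore] -/
theorem unipGL_inv_mul_single00_mul (x a : mixedSpace K) :
    (((unipGL K x)⁻¹ : GL (Fin 2) (mixedSpace K)) : Matrix (Fin 2) (Fin 2) (mixedSpace K)) * Matrix.single 0 0 a *
      ((unipGL K x : GL (Fin 2) (mixedSpace K)) : Matrix (Fin 2) (Fin 2) (mixedSpace K)) = Matrix.single 0 0 a + Matrix.single 0 1 (x * a) := by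
  have hinv : (unipGL K x)⁻¹ = unipGL K (-x) := by
    rw [eq_comm, ← mul_eq_one_iff_eq_inv, ← unipGL_add, neg_add_cancel]
    change ((unipotentGL2 (0 : mixedSpace K) : ↥(upperUnitriangular (Fin 2) (mixedSpace K))) : GL (Fin 2) (mixedSpace K)) = 1
    rw [unipotentGL2_zero]; rfl
  rw [hinv, coe_unipGL, coe_unipGL]
  refine Matrix.ext fun i j => ?_
  simp only [Matrix.mul_apply, Fin.sum_univ_two, Matrix.add_apply]
  fin_cases i <;> fin_cases j <;> simp [mul_comm]

/-- **`S_U(g)` commutes with the `𝔲`-letters on Gårding vectors**: `τ(E₀₁⊗b) S_U(g) v = S_U(g) τ(E₀₁⊗b) v`.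
[folklore] -/
theorem archDerivE_single01_unipSmoothing_of_mem (hτ : τ.IsStronglyContinuous) (hτb : ∀ g, ‖(τ g : E →L[ℂ] E)‖ ≤ 1)
    {g : mixedSpace K → ℂ} (hg : Continuous g) (hgs : HasCompactSupport g) {v : E} (hv : v ∈ archGardingSpace hcpt τ) (b : mixedSpace K) :
    archDerivE hcpt τ (Matrix.single 0 1 b) (unipSmoothing hcpt τ g v) = unipSmoothing hcpt τ g (archDerivE hcpt τ (Matrix.single 0 1 b) v) := by
  have h := archWordDerivE_unipSmoothing hτ hτb hg hgs hv [Matrix.single 0 1 b]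
  simp only [archWordDerivE_cons, archWordDerivE_nil, List.map_cons, List.map_nil, unipGL_inv_mul_single01_mul] at h
  exact h

/-- **Absorption of the `𝔲`-letters into the kernel**: for `g ∈ C¹_c(K_∞)` and EVERY `v ∈ E`,
`τ(E₀₁ ⊗ b) S_U(g) v = S_U(-∂_b g) v` (translate the kernel: `τ(n(sb)) S_U(g) v = ∫ g(x - sb) τ(n(x)) v dx`,
and differentiate under the integral sign). [cite: JacquetShalikaAJM1981, §3, (3.2)] -/
theorem archDerivE_single01_unipSmoothing (hτ : τ.IsStronglyContinuous) (hτb : ∀ g, ‖(τ g : E →L[ℂ] E)‖ ≤ 1)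
    {g : mixedSpace K → ℂ} (hg : ContDiff ℝ 1 g) (hgs : HasCompactSupport g) (b : mixedSpace K) (v : E) :
    archDerivE hcpt τ (Matrix.single 0 1 b) (unipSmoothing hcpt τ g v) = unipSmoothing hcpt τ (fun x => -(fderiv ℝ g x b)) v := by
  have hgc : Continuous g := hg.continuous
  have hg1 : Differentiable ℝ g := hg.differentiable one_ne_zero
  have hdc : Continuous fun x => fderiv ℝ g x b := (hg.continuous_fderiv one_ne_zero).clm_apply continuous_const
  have hds : HasCompactSupport fun x => fderiv ℝ g x b := hgs.fderiv_apply (𝕜 := ℝ) b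
  -- `τ(n(sb)) S_U(g) v = ∫ g (x - s b) • τ(n x) v dx`
  have htrans : ∀ s : ℝ, τ (toArch hcpt (expGL (s • Matrix.single (0 : Fin 2) (1 : Fin 2) b))) (unipSmoothing hcpt τ g v) =
      ∫ x, g (x - s • b) • τ (toArch hcpt (unipGL K x)) v := by
    intro s
    unfold unipSmoothing
    rw [← ContinuousLinearMap.integral_comp_comm _ (integrable_unipSmoothing_integrand hτ hgc hgs v)]
    have h1 : (fun x => τ (toArch hcpt (expGL (s • Matrix.single (0 : Fin 2) (1 : Fin 2) b))) (g x • τ (toArch hcpt (unipGL K x)) v)) =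
        fun x => g x • τ (toArch hcpt (unipGL K (s • b + x))) v := by
      funext x
      rw [map_smul, ← ContinuousLinearMap.comp_apply, ← ContinuousLinearMap.mul_def, ← map_mul, ← unipGL_smul_eq_expGL]
      have hmul : toArch hcpt (unipGL K (s • b)) * toArch hcpt (unipGL K x) = toArch hcpt (unipGL K (s • b + x)) :=
        Subtype.ext (by change unipGL K (s • b) * unipGL K x = unipGL K (s • b + x); exact (unipGL_add (s • b) x).symm)
      rw [hmul]
    rw [h1]
    have h2 := integral_sub_right_eq_self (μ := (volume : Measure (mixedSpace K))) (fun y => g (y - s • b) • τ (toArch hcpt (unipGL K y)) v) (-(s • b))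
    simp only [sub_neg_eq_add] at h2
    rw [← h2]
    refine integral_congr_ae (Eventually.of_forall fun x => ?_)
    change g x • τ (toArch hcpt (unipGL K (s • b + x))) v = g (x + s • b - s • b) • τ (toArch hcpt (unipGL K (x + s • b))) v
    rw [add_sub_cancel_right, add_comm x (s • b)]
  -- differentiate under the integral sign at `s = 0`
  set F : ℝ → mixedSpace K → E := fun s x => g (x - s • b) • τ (toArch hcpt (unipGL K x)) v with hF
  set F' : ℝ → mixedSpace K → E := fun s x => (-(fderiv ℝ g (x - s • b) b)) • τ (toArch hcpt (unipGL K x)) v with hF'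
  obtain ⟨C, hC⟩ := hds.exists_bound_of_continuous hdc
  set κ : Set (mixedSpace K) := tsupport (fun x => fderiv ℝ g x b) + Metric.closedBall (0 : mixedSpace K) ‖b‖ with hκ
  have hκc : IsCompact κ := hds.isCompact.add (isCompact_closedBall _ _)
  have hFc : ∀ s, Continuous (F s) := fun s =>
    (hgc.comp (continuous_id.sub continuous_const)).smul ((continuous_apply_toArch hcpt τ hτ v).comp continuous_unipGL)
  have hF'c : ∀ s, Continuous (F' s) := fun s =>
    ((hdc.comp (continuous_id.sub continuous_const)).neg).smul ((continuous_apply_toArch hcpt τ hτ v).comp continuous_unipGL)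
  have hint : Integrable (F 0) := by
    have : F 0 = fun x => g x • τ (toArch hcpt (unipGL K x)) v := by funext x; simp [hF]
    rw [this]; exact integrable_unipSmoothing_integrand hτ hgc hgs v
  have hbound : ∀ᵐ x ∂(volume : Measure (mixedSpace K)), ∀ s ∈ Metric.ball (0 : ℝ) 1, ‖F' s x‖ ≤ κ.indicator (fun _ => C * ‖v‖) x := by
    refine ae_of_all _ fun x s hs => ?_
    by_cases hx : x ∈ κ
    · rw [indicator_of_mem hx]
      change ‖(-(fderiv ℝ g (x - s • b) b)) • τ (toArch hcpt (unipGL K x)) v‖ ≤ C * ‖v‖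
      rw [_root_.norm_smul, norm_neg]
      refine mul_le_mul (hC _) ?_ (norm_nonneg _) ((norm_nonneg _).trans (hC 0))
      exact (ContinuousLinearMap.le_opNorm _ _).trans (by nlinarith [hτb (toArch hcpt (unipGL K x)), norm_nonneg v])
    · rw [indicator_of_notMem hx]
      change ‖(-(fderiv ℝ g (x - s • b) b)) • τ (toArch hcpt (unipGL K x)) v‖ ≤ 0
      have hnot : x - s • b ∉ tsupport (fun x => fderiv ℝ g x b) := by
        intro hmem
        apply hx
        refine ⟨x - s • b, hmem, s • b, ?_, by abel⟩
        rw [Metric.mem_closedBall, dist_zero_right, _root_.norm_smul]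
        have : ‖s‖ ≤ 1 := by
          rw [Metric.mem_ball, dist_zero_right] at hs; exact hs.le
        nlinarith [norm_nonneg b, norm_nonneg s]
      have h0 : fderiv ℝ g (x - s • b) b = 0 := image_eq_zero_of_notMem_tsupport (f := fun x => fderiv ℝ g x b) hnot
      rw [h0, neg_zero, zero_smul, norm_zero]
  have hdiff : ∀ᵐ x ∂(volume : Measure (mixedSpace K)), ∀ s ∈ Metric.ball (0 : ℝ) 1, HasDerivAt (fun s => F s x) (F' s x) s := by
    refine ae_of_all _ fun x s _ => ?_
    have h1 : HasDerivAt (fun s : ℝ => x - s • b) (-b) s := by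
      simpa using ((hasDerivAt_id s).smul_const b).const_sub x
    have h2 : HasDerivAt (fun s : ℝ => g (x - s • b)) (fderiv ℝ g (x - s • b) (-b)) s :=
      (hg1 (x - s • b)).hasFDerivAt.comp_hasDerivAt s h1
    have h3 := h2.smul_const (τ (toArch hcpt (unipGL K x)) v)
    simpa [hF, hF', map_neg] using h3
  have key := (hasDerivAt_integral_of_dominated_loc_of_deriv_le (μ := (volume : Measure (mixedSpace K))) (F := F) (F' := F')
    (x₀ := (0 : ℝ)) (Metric.ball_mem_nhds (0 : ℝ) one_pos) (Eventually.of_forall fun s => (hFc s).aestronglyMeasurable) hint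
    (hF'c 0).aestronglyMeasurable hbound ((integrable_indicator_iff hκc.isClosed.measurableSet).2 (integrableOn_const hκc.measure_lt_top.ne))
    hdiff).2
  -- conclude
  unfold archDerivE
  have hfun : (fun s : ℝ => τ (toArch hcpt (expGL (s • Matrix.single (0 : Fin 2) (1 : Fin 2) b))) (unipSmoothing hcpt τ g v)) = fun s => ∫ x, F s x := by
    funext s; rw [htrans s]
  rw [hfun, key.deriv]
  unfold unipSmoothing
  exact integral_congr_ae (Eventually.of_forall fun x => by simp [hF'])

/-- **`S_U(g) τ(E₀₁⊗b) v = S_U(-∂_b g) v`** for Gårding `v`. [folklore] -/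
theorem unipSmoothing_archDerivE_single01 (hτ : τ.IsStronglyContinuous) (hτb : ∀ g, ‖(τ g : E →L[ℂ] E)‖ ≤ 1)
    {g : mixedSpace K → ℂ} (hg : ContDiff ℝ 1 g) (hgs : HasCompactSupport g) {v : E} (hv : v ∈ archGardingSpace hcpt τ) (b : mixedSpace K) :
    unipSmoothing hcpt τ g (archDerivE hcpt τ (Matrix.single 0 1 b) v) = unipSmoothing hcpt τ (fun x => -(fderiv ℝ g x b)) v := by
  rw [← archDerivE_single01_unipSmoothing_of_mem hτ hτb hg.continuous hgs hv b, archDerivE_single01_unipSmoothing hτ hτb hg hgs b v]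

/-! ### 5. Commuting the diagonal letters -/

/-- The real coordinates of `K_∞` in `stdBasis`, as functions. [folklore] -/
theorem eq_sum_coord_smul_stdBasis (x : mixedSpace K) : x = ∑ i, (stdBasis K).repr x i • stdBasis K i :=
  ((stdBasis K).sum_repr x).symm

/-- `τ(E₀₁ ⊗ (x a)) v = Σ_i x_i • τ(E₀₁ ⊗ (e_i a)) v` for Gårding `v`. [folklore] -/
theorem archDerivE_single01_mul_eq_sum (hτ : τ.IsStronglyContinuous) {v : E} (hv : v ∈ archGardingSpace hcpt τ) (x a : mixedSpace K) :
    archDerivE hcpt τ (Matrix.single 0 1 (x * a)) v = ∑ i, ((stdBasis K).repr x i : ℂ) • archDerivE hcpt τ (Matrix.single 0 1 (stdBasis K i * a)) v := by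
  have hx : Matrix.single (0 : Fin 2) (1 : Fin 2) (x * a) = ∑ i, (stdBasis K).repr x i • Matrix.single (0 : Fin 2) (1 : Fin 2) (stdBasis K i * a) := by
    conv_lhs => rw [eq_sum_coord_smul_stdBasis x, Finset.sum_mul]
    rw [show Matrix.single (0 : Fin 2) (1 : Fin 2) (∑ i, ((stdBasis K).repr x i • stdBasis K i) * a) =
      ∑ i, Matrix.single (0 : Fin 2) (1 : Fin 2) (((stdBasis K).repr x i • stdBasis K i) * a) from
      _root_.map_sum (Matrix.singleAddMonoidHom (0 : Fin 2) (1 : Fin 2)) _ _]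
    refine Finset.sum_congr rfl fun i _ => ?_
    rw [smul_mul_assoc, Matrix.smul_single]
  rw [hx, archDerivE_sum_smul_dir hτ hv]

/-- **Commuting a diagonal letter past `S_U(g)`** (Gårding `v`, `g ∈ C¹_c`):
`τ(E₀₀ ⊗ a) S_U(g) v = S_U(g) τ(E₀₀ ⊗ a) v + Σ_i S_U(-∂_{e_i a}(x_i g)) v`
(`Ad(n(-x)) (E₀₀⊗a) = E₀₀⊗a + E₀₁⊗(xa)`, then absorb the `𝔲`-letter). [cite: JacquetShalikaAJM1981, §3, (3.2)–(3.3)] -/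
theorem archDerivE_single00_unipSmoothing (hτ : τ.IsStronglyContinuous) (hτb : ∀ g, ‖(τ g : E →L[ℂ] E)‖ ≤ 1)
    {g : mixedSpace K → ℂ} (hg : ContDiff ℝ 1 g) (hgs : HasCompactSupport g) {v : E} (hv : v ∈ archGardingSpace hcpt τ) (a : mixedSpace K) :
    archDerivE hcpt τ (Matrix.single 0 0 a) (unipSmoothing hcpt τ g v) =
      unipSmoothing hcpt τ g (archDerivE hcpt τ (Matrix.single 0 0 a) v) +
        ∑ i, unipSmoothing hcpt τ (fun x => -(fderiv ℝ (fun y => ((stdBasis K).repr y i : ℂ) * g y) x (stdBasis K i * a))) v := by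
  have hgc := hg.continuous
  have h := archWordDerivE_unipSmoothing hτ hτb hgc hgs hv [Matrix.single 0 0 a]
  simp only [archWordDerivE_cons, archWordDerivE_nil, List.map_cons, List.map_nil, unipGL_inv_mul_single00_mul] at h
  rw [h]
  -- split the letter
  have hsplit : (fun x => g x • τ (toArch hcpt (unipGL K x)) (archDerivE hcpt τ (Matrix.single 0 0 a + Matrix.single 0 1 (x * a)) v)) =
      fun x => g x • τ (toArch hcpt (unipGL K x)) (archDerivE hcpt τ (Matrix.single 0 0 a) v) +
        ∑ i, (((stdBasis K).repr x i : ℂ) * g x) • τ (toArch hcpt (unipGL K x)) (archDerivE hcpt τ (Matrix.single 0 1 (stdBasis K i * a)) v) := by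
    funext x
    rw [archDerivE_add_dir hτ hv, map_add, smul_add, archDerivE_single01_mul_eq_sum hτ hv, _root_.map_sum, Finset.smul_sum]
    congr 1
    refine Finset.sum_congr rfl fun i _ => ?_
    rw [map_smul, smul_smul, mul_comm]
  rw [hsplit]
  have hcoord : ∀ i, Continuous fun x : mixedSpace K => ((stdBasis K).repr x i : ℂ) :=
    fun i => Complex.continuous_ofReal.comp ((stdBasis K).coord i).continuous_of_finiteDimensional
  have hint0 := integrable_unipSmoothing_integrand hτ hgc hgs (archDerivE hcpt τ (Matrix.single 0 0 a) v)
  have hci : ∀ i, Continuous fun x => ((stdBasis K).repr x i : ℂ) * g x := fun i => (hcoord i).mul hgc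
  have hsi : ∀ i, HasCompactSupport fun x => ((stdBasis K).repr x i : ℂ) * g x := fun i => hgs.mul_left
  have hinti : ∀ i, Integrable fun x => (((stdBasis K).repr x i : ℂ) * g x) • τ (toArch hcpt (unipGL K x)) (archDerivE hcpt τ (Matrix.single 0 1 (stdBasis K i * a)) v) :=
    fun i => integrable_unipSmoothing_integrand hτ (hci i) (hsi i) _
  rw [integral_add hint0 (integrable_finsetSum _ fun i _ => hinti i), integral_finsetSum _ fun i _ => hinti i]
  congr 1
  refine Finset.sum_congr rfl fun i _ => ?_
  -- absorb the `𝔲`-letter into the kernel `x_i g`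
  have hdi : ContDiff ℝ 1 fun y => ((stdBasis K).repr y i : ℂ) * g y :=
    ((Complex.ofRealCLM.contDiff.comp ((stdBasis K).coord i).toContinuousLinearMap.contDiff).mul hg)
  have habs := unipSmoothing_archDerivE_single01 hτ hτb hdi (hsi i) hv (stdBasis K i * a)
  unfold unipSmoothing at habs
  exact habs

end Unipotent

/-! ### 6. Whittaker functionals and `S_U(g)` -/

section Whittaker

variable {hcpt : isCompact_glFiniteIntegralLevel 2 K}
  {E : Type*} [NormedAddCommGroup E] [InnerProductSpace ℂ E] [CompleteSpace E]
  {τ : ContRepresentation ℂ (AutomorphyDatum.gl 2 K hcpt).arch.carrier E}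

/-- **`t ↦ ℓ(τ(γ_t) y)` is continuous** for a Sobolev-bounded functional `ℓ`, a Gårding vector `y` and a
continuous family `γ_t ∈ GL₂(K_∞)` (as `continuous_kirillovFn`: `|ℓ(x)| ≤ C Σ_w ‖τ(w) x‖` and each
`t ↦ τ(w) τ(γ_t) y` is continuous). [folklore] -/
theorem continuous_apply_toArch_functional (hτ : τ.IsStronglyContinuous) {ℓ : archGardingSpace hcpt τ →ₗ[ℂ] ℂ}
    (hℓ : ∃ (C : ℝ) (𝒮 : Finset (List (Matrix (Fin 2) (Fin 2) (mixedSpace K)))), 0 ≤ C ∧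
      ∀ v : archGardingSpace hcpt τ, ‖ℓ v‖ ≤ C * ∑ w ∈ 𝒮, ‖archWordDerivE hcpt τ w v‖)
    {y : E} (hy : y ∈ archGardingSpace hcpt τ) {T : Type*} [TopologicalSpace T] {γ : T → GL (Fin 2) (mixedSpace K)} (hγ : Continuous γ) :
    Continuous fun t => ℓ ⟨τ (toArch hcpt (γ t)) y, apply_mem_archGardingSpace hτ _ hy⟩ := by
  obtain ⟨C, 𝒮, hC, hbound⟩ := hℓ
  set G : List (Matrix (Fin 2) (Fin 2) (mixedSpace K)) → T → E := fun w t => archWordDerivE hcpt τ w (τ (toArch hcpt (γ t)) y) with hG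
  have hGc : ∀ w, Continuous (G w) := fun w => continuous_archWordDerivE_apply_toArch hτ hy hγ w
  refine continuous_iff_continuousAt.2 fun t₀ => ?_
  rw [ContinuousAt, tendsto_iff_norm_sub_tendsto_zero]
  have hlim : Tendsto (fun t => C * ∑ w ∈ 𝒮, ‖G w t - G w t₀‖) (𝓝 t₀) (𝓝 0) := by
    have h : Tendsto (fun t => C * ∑ w ∈ 𝒮, ‖G w t - G w t₀‖) (𝓝 t₀) (𝓝 (C * ∑ w ∈ 𝒮, ‖G w t₀ - G w t₀‖)) :=
      (tendsto_finsetSum _ fun w _ => (((hGc w).sub continuous_const).norm).continuousAt).const_mul C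
    simpa using h
  refine squeeze_zero (fun t => norm_nonneg _) (fun t => ?_) hlim
  set x : archGardingSpace hcpt τ := ⟨τ (toArch hcpt (γ t)) y, apply_mem_archGardingSpace hτ _ hy⟩ -
    ⟨τ (toArch hcpt (γ t₀)) y, apply_mem_archGardingSpace hτ _ hy⟩ with hx
  have hdiff : ℓ ⟨τ (toArch hcpt (γ t)) y, apply_mem_archGardingSpace hτ _ hy⟩ - ℓ ⟨τ (toArch hcpt (γ t₀)) y, apply_mem_archGardingSpace hτ _ hy⟩ = ℓ x := by
    rw [← map_sub]
  rw [hdiff]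
  refine (hbound x).trans (mul_le_mul_of_nonneg_left (Finset.sum_le_sum fun w _ => le_of_eq ?_) hC)
  have h1 : (τ (toArch hcpt (γ t)) y) ∈ archGardingSpace hcpt τ := apply_mem_archGardingSpace hτ _ hy
  have h2 : (τ (toArch hcpt (γ t₀)) y) ∈ archGardingSpace hcpt τ := apply_mem_archGardingSpace hτ _ hy
  have hxE : (x : E) = τ (toArch hcpt (γ t)) y + (-1 : ℂ) • τ (toArch hcpt (γ t₀)) y := by
    rw [hx, Submodule.coe_sub, neg_one_smul, sub_eq_add_neg]
  rw [hxE, archWordDerivE_add hτ h1 (Submodule.smul_mem _ _ h2) w, archWordDerivE_smul hτ (-1) h2 w, neg_one_smul, ← sub_eq_add_neg]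

/-- **A continuous Whittaker functional sees `S_U(g)` as the scalar `∫ g ψ_∞`**: for Gårding `y`,
`ℓ(S_U(g) y) = (∫ g(x) ψ_∞(x) dx) ℓ(y)`, `ψ_∞(x) = archChar K 1 x`. [cite: JacquetShalikaAJM1981, §3, (3.3)] -/
theorem apply_unipSmoothing_eq (hτu : ∀ g, ‖(τ g : E →L[ℂ] E)‖ ≤ 1) {hτ : τ.IsStronglyContinuous}
    {ℓ : archGardingSpace hcpt τ →ₗ[ℂ] ℂ} (hℓ : IsArchContWhittakerFunctional hcpt τ hτ ℓ)
    {g : mixedSpace K → ℂ} (hg : Continuous g) (hgs : HasCompactSupport g) {y : E} (hy : y ∈ archGardingSpace hcpt τ) :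
    ℓ ⟨unipSmoothing hcpt τ g y, unipSmoothing_mem_archGardingSpace hτ hτu hg hgs hy⟩ = (∫ x, g x * archChar K 1 x) * ℓ ⟨y, hy⟩ := by
  haveI := isFiniteMeasure_unipMeasure (K := K) hgs.isCompact
  have hx := isGardingContComb_entry01_smul (hcpt := hcpt) (τ := τ) hg hy
  have h1 : unipSmoothing hcpt τ g y = ∫ h, τ (toArch hcpt h) (g (entry01 K h) • y) ∂(unipMeasure K (tsupport g)) := by
    unfold unipSmoothing
    rw [integral_smul_comp_unipGL_eq hg (continuous_apply_toArch hcpt τ hτ y)]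
    exact integral_congr_ae (Eventually.of_forall fun h => by simp only [map_smul])
  have hS : ∫ h, τ (toArch hcpt h) (g (entry01 K h) • y) ∂(unipMeasure K (tsupport g)) ∈ archGardingSpace hcpt τ := by
    rw [← h1]; exact unipSmoothing_mem_archGardingSpace hτ hτu hg hgs hy
  have key := apply_integral_apply_toArch_eq_integral hτ hτu (unipMeasure K (tsupport g)) (hgs.isCompact.image continuous_unipGL)
    (ae_mem_unipMeasure hgs.isCompact) hx hℓ.norm_le hS
  have hsub : (⟨unipSmoothing hcpt τ g y, unipSmoothing_mem_archGardingSpace hτ hτu hg hgs hy⟩ : archGardingSpace hcpt τ) = ⟨_, hS⟩ :=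
    Subtype.ext h1
  rw [hsub, key]
  -- evaluate `ℓ(τ(h)(g • y))` on the image of `n`
  have hval : ∀ h, ℓ ⟨τ (toArch hcpt h) (g (entry01 K h) • y), apply_mem_archGardingSpace hτ _ (hx.mem h)⟩ =
      g (entry01 K h) * ℓ ⟨τ (toArch hcpt h) y, apply_mem_archGardingSpace hτ _ hy⟩ := by
    intro h
    rw [← smul_eq_mul, ← map_smul]
    congr 1
    exact Subtype.ext (by simp)
  simp_rw [hval]
  unfold unipMeasure
  rw [integral_map continuous_unipGL.measurable.aemeasurable]
  · simp only [entry01_unipGL]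
    have hψ : ∀ x, ℓ ⟨τ (toArch hcpt (unipGL K x)) y, apply_mem_archGardingSpace hτ _ hy⟩ = archChar K 1 x * ℓ ⟨y, hy⟩ := by
      intro x
      have h := hℓ.map_unipotent (unipotentGL2 x) ⟨y, hy⟩
      rw [archWhittakerChar_unipotentGL2] at h
      exact h
    simp_rw [hψ]
    rw [← integral_mul_const]
    refine (setIntegral_eq_integral_of_forall_compl_eq_zero fun x hx' => ?_).trans ?_
    · rw [image_eq_zero_of_notMem_tsupport hx', zero_mul]
    · exact integral_congr_ae (Eventually.of_forall fun x => by ring)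
  · -- measurability of the integrand on `GL₂(K_∞)`
    have hc : Continuous fun h : GL (Fin 2) (mixedSpace K) => g (entry01 K h) * ℓ ⟨τ (toArch hcpt h) y, apply_mem_archGardingSpace hτ _ hy⟩ :=
      (hg.comp continuous_entry01).mul (continuous_apply_toArch_functional hτ hℓ.norm_le hy continuous_id)
    exact hc.aestronglyMeasurable

/-- **Scaled version**: `ℓ(∫ g(x) τ(n(u x)) y dx) = (∫ g(x) ψ_∞(u x) dx) ℓ(y)` for a unit `u`. [folklore] -/
theorem apply_integral_smul_unipGL_mul_eq (hτu : ∀ g, ‖(τ g : E →L[ℂ] E)‖ ≤ 1) {hτ : τ.IsStronglyContinuous}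
    {ℓ : archGardingSpace hcpt τ →ₗ[ℂ] ℂ} (hℓ : IsArchContWhittakerFunctional hcpt τ hτ ℓ)
    {g : mixedSpace K → ℂ} (hg : Continuous g) (hgs : HasCompactSupport g) {y : E} (hy : y ∈ archGardingSpace hcpt τ) (u : (mixedSpace K)ˣ)
    (hS : ∫ x, g x • τ (toArch hcpt (unipGL K ((u : mixedSpace K) * x))) y ∈ archGardingSpace hcpt τ) :
    ℓ ⟨∫ x, g x • τ (toArch hcpt (unipGL K ((u : mixedSpace K) * x))) y, hS⟩ = (∫ x, g x * archChar K 1 ((u : mixedSpace K) * x)) * ℓ ⟨y, hy⟩ := by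
  set c : mixedSpace K → GL (Fin 2) (mixedSpace K) := fun x => unipGL K ((u : mixedSpace K) * x) with hc
  have hcc : Continuous c := continuous_unipGL.comp (continuous_const.mul continuous_id)
  set ν : Measure (GL (Fin 2) (mixedSpace K)) := (volume.restrict (tsupport g)).map c with hν
  haveI : IsFiniteMeasure (volume.restrict (tsupport g)) := ⟨by rw [Measure.restrict_apply_univ]; exact hgs.isCompact.measure_lt_top⟩
  haveI : IsFiniteMeasure ν := by rw [hν]; infer_instance
  have hκ : IsCompact (c '' tsupport g) := hgs.isCompact.image hcc
  have hνκ : ∀ᵐ h ∂ν, h ∈ c '' tsupport g := by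
    rw [hν]
    refine (ae_map_iff hcc.measurable.aemeasurable hκ.isClosed.measurableSet).2 ?_
    rw [ae_restrict_iff' (isClosed_tsupport g).measurableSet]
    exact ae_of_all _ fun x hx => ⟨x, hx, rfl⟩
  -- the family `h ↦ g(u⁻¹ entry₀₁ h) • y`
  set G : GL (Fin 2) (mixedSpace K) → ℂ := fun h => g (((u⁻¹ : (mixedSpace K)ˣ) : mixedSpace K) * entry01 K h) with hG
  have hGc : Continuous G := hg.comp (continuous_const.mul continuous_entry01)
  have hGc' : ∀ x, G (c x) = g x := by
    intro x
    simp only [hG, hc, entry01_unipGL, ← mul_assoc, Units.inv_mul, one_mul]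
  have hx : IsGardingContComb hcpt τ (fun h : GL (Fin 2) (mixedSpace K) => G h • y) := (isGardingContComb_const hy).smul hGc
  -- the integral as a `ν`-smoothing
  have hrepr : ∫ x, g x • τ (toArch hcpt (c x)) y = ∫ h, τ (toArch hcpt h) (G h • y) ∂ν := by
    rw [hν, integral_map (f := fun h => τ (toArch hcpt h) (G h • y)) hcc.measurable.aemeasurable]
    · symm
      refine (setIntegral_eq_integral_of_forall_compl_eq_zero fun x hx' => ?_).trans ?_
      · rw [hGc' x, image_eq_zero_of_notMem_tsupport hx', zero_smul, map_zero]
      · exact integral_congr_ae (Eventually.of_forall fun x => by simp only [hGc' x, map_smul])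
    · exact (by simpa only [one_mul] using continuous_apply_toArch_mul_comb hτ hx 1 : Continuous fun h => τ (toArch hcpt h) (G h • y)).aestronglyMeasurable
  have hS' : ∫ h, τ (toArch hcpt h) (G h • y) ∂ν ∈ archGardingSpace hcpt τ := by rw [← hrepr]; exact hS
  have key := apply_integral_apply_toArch_eq_integral hτ hτu ν hκ hνκ hx hℓ.norm_le hS'
  have hsub : (⟨∫ x, g x • τ (toArch hcpt (c x)) y, hS⟩ : archGardingSpace hcpt τ) = ⟨_, hS'⟩ := Subtype.ext hrepr
  rw [hsub, key]
  have hval : ∀ h, ℓ ⟨τ (toArch hcpt h) (G h • y), apply_mem_archGardingSpace hτ _ (hx.mem h)⟩ =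
      G h * ℓ ⟨τ (toArch hcpt h) y, apply_mem_archGardingSpace hτ _ hy⟩ := by
    intro h
    rw [← smul_eq_mul, ← map_smul]
    congr 1
    exact Subtype.ext (by simp)
  simp_rw [hval]
  rw [hν, integral_map hcc.measurable.aemeasurable]
  · have hψ : ∀ x, ℓ ⟨τ (toArch hcpt (c x)) y, apply_mem_archGardingSpace hτ _ hy⟩ = archChar K 1 ((u : mixedSpace K) * x) * ℓ ⟨y, hy⟩ := by
      intro x
      have h := hℓ.map_unipotent (unipotentGL2 ((u : mixedSpace K) * x)) ⟨y, hy⟩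
      rw [archWhittakerChar_unipotentGL2] at h
      exact h
    simp_rw [hGc', hψ]
    rw [← integral_mul_const]
    refine (setIntegral_eq_integral_of_forall_compl_eq_zero fun x hx' => ?_).trans ?_
    · rw [image_eq_zero_of_notMem_tsupport hx', zero_mul]
    · exact integral_congr_ae (Eventually.of_forall fun x => by ring)
  · have hc' : Continuous fun h : GL (Fin 2) (mixedSpace K) => G h * ℓ ⟨τ (toArch hcpt h) y, apply_mem_archGardingSpace hτ _ hy⟩ :=
      hGc.mul (continuous_apply_toArch_functional hτ hℓ.norm_le hy continuous_id)
    exact hc'.aestronglyMeasurable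

/-- **The Kirillov function of a `U`-smoothed vector**:
`W_{S_U(g) v}(u) = (∫ g(x) ψ_∞(u x) dx) · W_v(u)` (`a(u) n(x) = n(ux) a(u)` and the Whittaker covariance).
[cite: JacquetShalikaAJM1981, §3, (3.3)] -/
theorem kirillovFn_unipSmoothing (hτu : ∀ g, ‖(τ g : E →L[ℂ] E)‖ ≤ 1) {hτ : τ.IsStronglyContinuous}
    {ℓ : archGardingSpace hcpt τ →ₗ[ℂ] ℂ} (hℓ : IsArchContWhittakerFunctional hcpt τ hτ ℓ)
    {g : mixedSpace K → ℂ} (hg : Continuous g) (hgs : HasCompactSupport g) (v : archGardingSpace hcpt τ) (u : (mixedSpace K)ˣ) :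
    kirillovFn hτ ℓ ⟨unipSmoothing hcpt τ g v, unipSmoothing_mem_archGardingSpace hτ hτu hg hgs v.2⟩ u =
      (∫ x, g x * archChar K 1 ((u : mixedSpace K) * x)) * kirillovFn hτ ℓ v u := by
  have hy : τ (toArch hcpt (diagGL2 u 1)) (v : E) ∈ archGardingSpace hcpt τ := apply_mem_archGardingSpace hτ _ v.2
  -- `τ(a(u)) S_U(g) v = ∫ g(x) τ(n(ux)) τ(a(u)) v dx`
  have hcomm : τ (toArch hcpt (diagGL2 u 1)) (unipSmoothing hcpt τ g v) =
      ∫ x, g x • τ (toArch hcpt (unipGL K ((u : mixedSpace K) * x))) (τ (toArch hcpt (diagGL2 u 1)) (v : E)) := by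
    unfold unipSmoothing
    rw [← ContinuousLinearMap.integral_comp_comm _ (integrable_unipSmoothing_integrand hτ hg hgs (v : E))]
    refine integral_congr_ae (Eventually.of_forall fun x => ?_)
    change τ (toArch hcpt (diagGL2 u 1)) (g x • τ (toArch hcpt (unipGL K x)) (v : E)) =
      g x • τ (toArch hcpt (unipGL K ((u : mixedSpace K) * x))) (τ (toArch hcpt (diagGL2 u 1)) (v : E))
    rw [map_smul, ← ContinuousLinearMap.comp_apply, ← ContinuousLinearMap.mul_def, ← map_mul,
      ← ContinuousLinearMap.comp_apply (τ (toArch hcpt (unipGL K ((u : mixedSpace K) * x)))) (τ (toArch hcpt (diagGL2 u 1))),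
      ← ContinuousLinearMap.mul_def, ← map_mul]
    have hmul : toArch hcpt (diagGL2 u 1) * toArch hcpt (unipGL K x) = toArch hcpt (unipGL K ((u : mixedSpace K) * x)) * toArch hcpt (diagGL2 u 1) := by
      refine Subtype.ext ?_
      change diagGL2 u 1 * unipGL K x = unipGL K ((u : mixedSpace K) * x) * diagGL2 u 1
      have h := diagGL2_mul_unipotentGL2_mul_inv (R := mixedSpace K) u x
      rw [mul_inv_eq_iff_eq_mul] at h
      exact h
    rw [hmul]
  have hS : ∫ x, g x • τ (toArch hcpt (unipGL K ((u : mixedSpace K) * x))) (τ (toArch hcpt (diagGL2 u 1)) (v : E)) ∈ archGardingSpace hcpt τ :=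
    weightedIntegral_apply_toArch_mem_archGardingSpace volume (continuous_unipGL.comp (continuous_const.mul continuous_id)) hg hgs hτ hτu hy
  rw [kirillovFn_apply, kirillovFn_apply]
  have hsub : (⟨τ (toArch hcpt (diagGL2 u 1)) (unipSmoothing hcpt τ g v), apply_mem_archGardingSpace hτ _
      (unipSmoothing_mem_archGardingSpace hτ hτu hg hgs v.2)⟩ : archGardingSpace hcpt τ) = ⟨_, hS⟩ := Subtype.ext hcomm
  change ℓ ⟨τ (toArch hcpt (diagGL2 u 1)) (unipSmoothing hcpt τ g v), _⟩ = _
  rw [hsub, apply_integral_smul_unipGL_mul_eq hτu hℓ hg hgs hy u hS]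

end Whittaker

end Literature.NumberTheory.Automorphic
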